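import Summits.AtomisticToContinuum.HydrodynamicLimit.Theorems.AntiMazurCoboundariesCorrectorPressureDecayKiferReduction

/-!
# Strategy census r1 (second-opinion crux-strategist) — the EXACTLY-STATIONARY shadow of the crux, and the
bounded-horizon strengthening, typed

Crux stmt-AtomisticToContinuum-14135 `AntiMazurCoboundaries.CorrectorPressureDecay` ("X"); companion of
`STRATEGY-CENSUS.md` PART II (r1). Everything here is sorry-free.

* `InvariantStateDualDecay` (ISDD): the normal form `AlmostStationaryDualDecay` (ASDD, p138320: ASDD ↔ X) restricted to laws
  `Q` that are EXACTLY invariant under the finite-`N` flow. PROVED: `ASDD → ISDD`, hence `X → ISDD`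
  (`invariantStateDualDecay_of_correctorPressureDecay`). Census point: ISDD is the ONLY part of X that speaks about a
  classification of (exactly) stationary states, and it is decidable per `N` by finite-`N` shell ergodicity (Simányi 2013, tree
  fact `simanyi_hardBall_ergodic`) plus the landed `σ(P,E)`-slice floor of line `almost-invariant-duality` (ThermodynamicProfile
  p99886, ShellChernoff p101856, SliceGlue p103845, GaussianShellMarginal p108725, ShellMeanBound p109893) — no uniformity in `N`
  beyond `N ≥ N₀(δ)` is asked, because an invariant `Q` is `η`-almost stationary for EVERY `η`. So the hardness of X is not the
  Boltzmann-hypothesis CLASSIFICATION at finite `N`; it is almost-stationarity at a rate `η(δ) → 0` fixed BEFORE `N → ∞`, i.e.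
  long-but-finite kinetic times of the infinite-volume gas (census PART II §0, §Transfer T-r1-6).
* `KineticFluxLdDecayWithin T`: the shared wall stmt-10967 with the window confined to `τ ≤ T` (a bounded kinetic horizon, `T`
  fixed before `δ`). PROVED only the sanity direction `KineticFluxLdDecayWithin T → KineticFluxLdDecay`; the census records why
  its NEGATION (every proof of X needs unbounded horizons) is itself a dynamical statement — a linear-response persistence LOWER
  bound for the tilted gas — available from MD (item evidence j013779–j013800: `S·r(S) → 2·GK > 0`) and from linearised
  Boltzmann theory, but not as a cheap Lean theorem (census PART II §Negation N-r1-3).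
-/

noncomputable section

open MeasureTheory ProbabilityTheory Set

namespace Summit.AtomisticToContinuum.HydrodynamicLimit.Cruxes.CorrectorPressureDecay.StrategyCensusR1

open Literature.MathematicalPhysics.KineticTheory (T3 V3 hsDiameter localGibbsLaw)
open Literature.Analysis.FluidPDE (HardSphereFlow Config)
open Summit.AtomisticToContinuum.HydrodynamicLimit.Theses.AntiMazurCoboundaries (CorrectorPressureDecay
  KineticFluxLdDecay)
open Summit.AtomisticToContinuum.HydrodynamicLimit.Theorems.KiferCompactification (AlmostStationaryDualDecay
  almostStationaryDualDecay_iff_correctorPressureDecay)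

/-- **Invariant-state dual decay** (ISDD) — the exactly-stationary shadow of the crux: in the frame of
`AlmostStationaryDualDecay`, for `N ≥ N₀(δ)`, every hard-sphere flow `Φ` and every probability law `Q` with
`KL(Q ‖ G_N) < ∞` that is INVARIANT under every `Φ.flow u`, the fast one-body bias is priced by the entropy:
`E_Q[Σᵢ φ(xᵢ) g((vᵢ − u₀)/√θ)] − KL(Q ‖ G_N) ≤ δ (N+1)`. A consequence of X (below); per `N` it follows from shell
ergodicity + the slice floor (census), so it carries none of X's difficulty. Posited for the census only. -/
def InvariantStateDualDecay : Prop :=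
  ∀ (a θ : ℝ) (u₀ : V3), 0 < a → 0 < θ → ∃ σ₀ : ℝ, 0 < σ₀ ∧ ∀ σ : ℝ, 0 < σ → σ < σ₀ →
    (∀ (N : ℕ) (Φ : HardSphereFlow (Literature.Analysis.FluidPDE.Torus.geometry (Fin 3)) (hsDiameter σ N) (N + 1)),
      IsProbabilityMeasure (localGibbsLaw σ (fun _ => a) (fun _ => u₀) (fun _ => θ) N Φ)) ∧
    ∃ κ : ℝ, 0 < κ ∧ ∀ (φ : T3 → ℝ) (g : V3 → ℝ), Continuous φ → Continuous g → (∀ x, |φ x| ≤ 1) →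
      (∀ v, |g v| ≤ κ) →
      (∀ (c₀ c₂ : ℝ) (b : V3), ∫ v, g v * (c₀ + inner ℝ b v + c₂ * ‖v‖ ^ 2) ∂(stdGaussian V3) = 0) →
      ∀ δ : ℝ, 0 < δ → ∃ N₀ : ℕ, ∀ N : ℕ, N₀ ≤ N →
        ∀ Φ : HardSphereFlow (Literature.Analysis.FluidPDE.Torus.geometry (Fin 3)) (hsDiameter σ N) (N + 1),
        ∀ Q : Measure (Config (N + 1) (Fin 3) T3), IsProbabilityMeasure Q →
          InformationTheory.klDiv Q (localGibbsLaw σ (fun _ => a) (fun _ => u₀) (fun _ => θ) N Φ) ≠ ⊤ →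
          (∀ u : ℝ, MeasurePreserving (Φ.flow u) Q Q) →
          (∫ z, (∑ i, φ (z i).1 * g ((Real.sqrt θ)⁻¹ • ((z i).2 - u₀))) ∂Q) -
              (InformationTheory.klDiv Q
                (localGibbsLaw σ (fun _ => a) (fun _ => u₀) (fun _ => θ) N Φ)).toReal ≤ δ * (N + 1)

/-- **ASDD ⟹ ISDD**: an invariant law is `η`-almost stationary for every `η > 0` (its drift is zero), so the almost-stationary
normal form of the crux specialises to invariant laws. -/
theorem invariantStateDualDecay_of_almostStationaryDualDecay (h : AlmostStationaryDualDecay) :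
    InvariantStateDualDecay := by
  intro a θ u₀ ha hθ
  obtain ⟨σ₀, hσ₀, H⟩ := h a θ u₀ ha hθ
  refine ⟨σ₀, hσ₀, fun σ hσ hσ' => ?_⟩
  obtain ⟨hprob, κ, hκ, Hκ⟩ := H σ hσ hσ'
  refine ⟨hprob, κ, hκ, ?_⟩
  intro φ g hφ hg hφ1 hgκ horth δ hδ
  obtain ⟨η, hη, N₀, HN⟩ := Hκ φ g hφ hg hφ1 hgκ horth δ hδ
  refine ⟨N₀, fun N hN Φ Q hQ hKL hinv => HN N hN Φ Q hQ hKL ?_⟩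
  intro f C hf hfC u hu
  have hC : 0 ≤ C := (abs_nonneg _).trans (hfC (fun _ => ((0 : T3), (0 : V3))))
  have hint : ∫ z, f (Φ.flow u z) ∂Q = ∫ z, f z ∂Q := by
    have h1 : ∫ z, f z ∂(Q.map (Φ.flow u)) = ∫ z, f (Φ.flow u z) ∂Q :=
      integral_map (hinv u).measurable.aemeasurable hf.aestronglyMeasurable
    rw [(hinv u).map_eq] at h1
    exact h1.symm
  rw [hint, sub_self, abs_zero]
  positivity

/-- **X ⟹ ISDD**: the crux implies the exactly-stationary entropic one-body bound, through the landed normal form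
`almostStationaryDualDecay_iff_correctorPressureDecay` (p138320). -/
theorem invariantStateDualDecay_of_correctorPressureDecay (hX : CorrectorPressureDecay) : InvariantStateDualDecay :=
  invariantStateDualDecay_of_almostStationaryDualDecay (almostStationaryDualDecay_iff_correctorPressureDecay.mpr hX)

/-- **The bounded-horizon strengthening of the shared wall** stmt-10967: `KineticFluxLdDecay` with the kinetic window
confined to `τ ≤ T`, the bound `T` (in units of `ℓ/√θ`, i.e. `≍ T σ²` mean free times) fixed BEFORE the observable and the
tolerance. Believed FALSE for every `T` (census PART II §Negation N-r1-3: the window pressure of the velocity-tilted gas is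
`≳ κ² c_g t_rel/τ` by linear response; MD legs j013779–j013800 measure `S·r(S) → 2·GK > 0`), which is the precise sense in which
"X needs an infinite kinetic validity horizon at fixed density"; a Lean refutation needs a persistence LOWER bound for the true
dynamics and is recorded as a disprover target, not claimed. -/
def KineticFluxLdDecayWithin (T : ℝ) : Prop :=
  ∀ (a θ : ℝ) (u₀ : V3), 0 < a → 0 < θ → ∃ σ₀ : ℝ, 0 < σ₀ ∧ ∀ σ : ℝ, 0 < σ → σ < σ₀ →
    (∀ (N : ℕ) (Φ : HardSphereFlow (Literature.Analysis.FluidPDE.Torus.geometry (Fin 3)) (hsDiameter σ N) (N + 1)),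
      IsProbabilityMeasure (localGibbsLaw σ (fun _ => a) (fun _ => u₀) (fun _ => θ) N Φ)) ∧
    ∃ κ : ℝ, 0 < κ ∧ ∀ (φ : T3 → ℝ) (g : V3 → ℝ), Continuous φ → Continuous g → (∀ x, |φ x| ≤ 1) →
      (∀ v, |g v| ≤ κ) →
      (∀ (c₀ c₂ : ℝ) (b : V3), ∫ v, g v * (c₀ + inner ℝ b v + c₂ * ‖v‖ ^ 2) ∂(stdGaussian V3) = 0) →
      ∀ δ : ℝ, 0 < δ → ∃ τ : ℝ, 0 < τ ∧ τ ≤ T ∧ ∃ N₀ : ℕ, ∀ N : ℕ, N₀ ≤ N →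
        ∀ Φ : HardSphereFlow (Literature.Analysis.FluidPDE.Torus.geometry (Fin 3)) (hsDiameter σ N) (N + 1),
        ∫⁻ z, ENNReal.ofReal (Real.exp ((τ * ((N + 1 : ℕ) : ℝ) ^ (-(1 / 3 : ℝ)))⁻¹ *
            ∫ s in (0 : ℝ)..(τ * ((N + 1 : ℕ) : ℝ) ^ (-(1 / 3 : ℝ))),
              ∑ i, φ (Φ.flow s z i).1 * g ((Real.sqrt θ)⁻¹ • ((Φ.flow s z i).2 - u₀))))
          ∂(localGibbsLaw σ (fun _ => a) (fun _ => u₀) (fun _ => θ) N Φ) ≤ ENNReal.ofReal (Real.exp (δ * (N + 1)))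

/-- Sanity: the bounded-horizon form is a STRENGTHENING of the shared wall (forget the bound `τ ≤ T`). -/
theorem kineticFluxLdDecay_of_within {T : ℝ} (h : KineticFluxLdDecayWithin T) : KineticFluxLdDecay := by
  intro a θ u₀ ha hθ
  obtain ⟨σ₀, hσ₀, H⟩ := h a θ u₀ ha hθ
  refine ⟨σ₀, hσ₀, fun σ hσ hσ' => ?_⟩
  obtain ⟨hprob, κ, hκ, Hκ⟩ := H σ hσ hσ'
  refine ⟨hprob, κ, hκ, ?_⟩
  intro φ g hφ hg hφ1 hgκ horth δ hδ
  obtain ⟨τ, hτ, -, N₀, HN⟩ := Hκ φ g hφ hg hφ1 hgκ horth δ hδ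
  exact ⟨τ, hτ, N₀, HN⟩

/-- Hence the bounded-horizon form also implies the crux (through p99142's converse half). -/
theorem correctorPressureDecay_of_within {T : ℝ} (h : KineticFluxLdDecayWithin T) : CorrectorPressureDecay :=
  almostStationaryDualDecay_iff_correctorPressureDecay.mp
    ((Summit.AtomisticToContinuum.HydrodynamicLimit.Theorems.KiferCompactification.almostStationaryDualDecay_iff_kineticFluxLdDecay).mpr
      (kineticFluxLdDecay_of_within h))

end Summit.AtomisticToContinuum.HydrodynamicLimit.Cruxes.CorrectorPressureDecay.StrategyCensusR1

end
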